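import Summits.QuantumFields.BalabanUV.T4Continuum.Support.NE7K1LinSchurLineU1Sharp

/-!
# NE7K1LinScalarWitness — row NE7 (node U5), candidate route HOM, path H1L, cell K1-lin(s): the SCALAR WITNESS that the `∂_s`
# letter of an interpolated line `L(r) = (1−r)P₀ + rP₁` is MESH-DEPENDENT WITHOUT a comparison of `P₀` with `P₁`, although both
# endpoints are uniformly coercive — `P₀ = n²`, `P₁ = 1` (1×1): `|(L(s)⁻¹ − L(1)⁻¹)| ≥ (3∕8)·n²·|1 − s|` at `s = 1 − n⁻²`

Lineage `b2b-balaban-t4-ne7-p2` (CRUX PROVER NE7 #2), generation 64; companion of `NE7K1LinSchurLineDerivRel` (located fact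
`schurTest_runA_ge`: the Schur-test constants of `NE7K1LinSchurLineDeriv` are mesh-dependent at U = 1; form-relative letter
`inv_line_sub_inv_line_sq_le`: mesh-free GIVEN the two-run comparability `c₁P₀ ≤ P₁`, `|P₁ − P₀| ≤ KP₀`).  THIS FILE closes the
argument «and without comparability nothing better is true» in kernel on the smallest model: one site, `P₀ = n²·1`, `P₁ = 1`
(both `1`-coercive for every `n ≥ 1` — so every VALUE bound `‖L(r)⁻¹‖ ≤ 1` is mesh-free — but `P₀ ≤ C·P₁` fails for `n² > C`):
`L(r)⁻¹ = ((1−r)n² + r)⁻¹`, and between `s = 1 − n⁻²` and `t = 1` the propagator moves by `(1 − n⁻²)∕(2 − n⁻²) ≥ 3∕7` while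
`|t − s| = n⁻²`: the Lipschitz quotient is `≥ (3∕8)·n²` (`scalar_lipschitz_quotient_ge`).  So the η-uniform `∂_s` letter
GENUINELY needs the lower comparability `c₁·P_A ≤ P_B^{Schur}` (`NE7K1LinTwoRunLower`), not merely a better Schur test.
[folklore] arithmetic; nothing printed asserted; no `sorry`.  FIXED FINITE T⁴, rung (B)+1; NE7 NOT PRINTED ∕ NOT PROVED; spine
0∕9; NOT infinite volume, NOT mass gap, NOT Clay.  HONEST DEPENDENCY: continuum YM on T⁴ ⇐ BetaPertH ∧ nine spine estimates (0/9
proved); BetaPertH ⇐ (D1) ∧ (D4) ∧ CAP+tail; G-an2-4 gates asym, D1 and NE2/3/4.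
-/

noncomputable section

open Matrix

namespace Summit.QuantumFields.BalabanUV.T4Continuum.NE7K1LinScalarWitness

open NE7K1LinSchurLineU1Sharp (inv_smul_eq)

/-- both endpoints of the scalar model are `1`-coercive, uniformly in `n ≥ 1` (so Combes–Thomas-type VALUE bounds are mesh-free).
[folklore] -/
theorem scalar_endpoints_coercive (n : ℕ) (hn : 1 ≤ n) (v : Unit → ℝ) :
    1 * (v ⬝ᵥ v) ≤ v ⬝ᵥ (((n : ℝ) ^ 2) • (1 : Matrix Unit Unit ℝ)).mulVec v ∧
      1 * (v ⬝ᵥ v) ≤ v ⬝ᵥ (1 : Matrix Unit Unit ℝ).mulVec v := by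
  have hn1 : (1 : ℝ) ≤ (n : ℝ) ^ 2 := one_le_pow₀ (by exact_mod_cast hn)
  have hvv : 0 ≤ v ⬝ᵥ v := by
    simp only [dotProduct]; exact Finset.sum_nonneg fun _ _ => mul_self_nonneg _
  refine ⟨?_, by rw [one_mulVec, one_mul]⟩
  rw [smul_mulVec, one_mulVec, dotProduct_smul, smul_eq_mul]
  nlinarith

/-- the line of the scalar model is the scalar `(1−r)n² + r`. [folklore] -/
theorem scalar_line_eq (n : ℕ) (r : ℝ) :
    (1 - r) • (((n : ℝ) ^ 2) • (1 : Matrix Unit Unit ℝ)) + r • (1 : Matrix Unit Unit ℝ) =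
      ((1 - r) * (n : ℝ) ^ 2 + r) • (1 : Matrix Unit Unit ℝ) := by
  rw [smul_smul, ← add_smul]

/-- **THE LIPSCHITZ QUOTIENT OF THE SCALAR LINE IS `≥ (3∕8)n²`** between `s = 1 − n⁻²` and `t = 1` (`n ≥ 2`): with
`P₀ = n²·1`, `P₁ = 1`, `L(r) = (1−r)P₀ + rP₁`, `(3∕8)·n²·|t − s| ≤ |(L(s)⁻¹ − L(t)⁻¹)₀₀|`. [folklore] -/
theorem scalar_lipschitz_quotient_ge (n : ℕ) (hn : 2 ≤ n) :
    (3 / 8 : ℝ) * (n : ℝ) ^ 2 * |(1 : ℝ) - (1 - ((n : ℝ) ^ 2)⁻¹)| ≤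
      |(((1 - (1 - ((n : ℝ) ^ 2)⁻¹)) • (((n : ℝ) ^ 2) • (1 : Matrix Unit Unit ℝ)) +
            (1 - ((n : ℝ) ^ 2)⁻¹) • (1 : Matrix Unit Unit ℝ))⁻¹ -
          ((1 - (1 : ℝ)) • (((n : ℝ) ^ 2) • (1 : Matrix Unit Unit ℝ)) + (1 : ℝ) • (1 : Matrix Unit Unit ℝ))⁻¹) () ()| := by
  have hn2 : (2 : ℝ) ≤ n := by exact_mod_cast hn
  have hN : (4 : ℝ) ≤ (n : ℝ) ^ 2 := by nlinarith
  set x : ℝ := ((n : ℝ) ^ 2)⁻¹ with hx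
  have hxpos : 0 < x := by positivity
  have hNx : (n : ℝ) ^ 2 * x = 1 := mul_inv_cancel₀ (by positivity)
  have hx4 : x ≤ 1 / 4 := by
    rw [hx, inv_le_comm₀ (by positivity) (by norm_num)]
    linarith
  have e1 : (1 - (1 - x)) • (((n : ℝ) ^ 2) • (1 : Matrix Unit Unit ℝ)) + (1 - x) • (1 : Matrix Unit Unit ℝ) =
      (2 - x) • (1 : Matrix Unit Unit ℝ) := by
    rw [scalar_line_eq]
    congr 1
    linear_combination hNx
  have e2 : (1 - (1 : ℝ)) • (((n : ℝ) ^ 2) • (1 : Matrix Unit Unit ℝ)) + (1 : ℝ) • (1 : Matrix Unit Unit ℝ) =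
      (1 : Matrix Unit Unit ℝ) := by
    rw [sub_self, zero_smul, zero_add, one_smul]
  have h2x : (2 : ℝ) - x ≠ 0 := by linarith
  rw [e1, e2, inv_smul_eq h2x, inv_one, Matrix.sub_apply, Matrix.smul_apply, Matrix.one_apply_eq, smul_eq_mul,
    mul_one, sub_sub_cancel, abs_of_pos hxpos]
  have hle : (2 - x)⁻¹ - 1 ≤ 0 := by
    rw [sub_nonpos, inv_le_comm₀ (by linarith) one_pos, inv_one]
    linarith
  rw [abs_of_nonpos hle, neg_sub]
  -- `(3∕8)·n²·x = 3∕8 ≤ 1 − (2 − x)⁻¹ = (1 − x)∕(2 − x)`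
  have hkey : (3 / 8 : ℝ) ≤ 1 - (2 - x)⁻¹ := by
    rw [show (1 : ℝ) - (2 - x)⁻¹ = (1 - x) / (2 - x) by field_simp; ring, le_div_iff₀ (by linarith)]
    nlinarith
  calc (3 / 8 : ℝ) * (n : ℝ) ^ 2 * x = 3 / 8 * ((n : ℝ) ^ 2 * x) := by ring
    _ = 3 / 8 := by rw [hNx, mul_one]
    _ ≤ 1 - (2 - x)⁻¹ := hkey

end Summit.QuantumFields.BalabanUV.T4Continuum.NE7K1LinScalarWitness
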